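import Summits.QuantumFields.YangMills.Theorems.BalabanUVNodesN15CurvedGluingCubeSmoothCutAdjointLetter
import Summits.QuantumFields.YangMills.Theorems.BalabanUVNodesN15CurvedGluingSpeciesCommutatorAdjointSandwich
import Summits.QuantumFields.YangMills.Theorems.BalabanUVNodesN15CurvedGluingCubeSmoothCutDressed
import Summits.QuantumFields.YangMills.Theorems.BalabanUVNodesN15TwoSpacingGluingNeumannKnitRightCube
import Summits.QuantumFields.YangMills.Theorems.BalabanUVNodesN15CurvedGluingCubeDressedGeneralRemainderRow
import HarnessLib

/-!
# THE ADJOINT REMAINDER ROW OF THE ADJOINT-SIDE DRESSED SMOOTH-CUT CUBE — `X°∘[Σ∇*∇ + W + N_L − 𝒱, M_h] ≤ 1_S(y)·Θ·e^{−ρ₃d}` (FILE 147∕149's `hKc`) from the cube's entry 0 (file 34) and its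
# SANDWICHED right entries in the adjoint form (FILES 148∕150: `X°∘∇^±_μ∘M_χ = (Ñ_𝒲∘M_χ̃∘T^±_μ)∘M_χ`) — dag-n15-w5's ★★★ `hasMaj_dressedV_comp_commOp_cubeOp_out` WITHOUT the mixed rows
# (dag-n15-c g18, FILE 153; N15 = NE2, s1 «background-layer OPERATOR ingredient»)

Cell `pub-ymgap`, seat `pub-ymgap-dag-n15-c` (R134 (a); HUMAN RULING D-0062), generation 18.  `bears_on: R4∕N15 · K3⁸ SpineGivenEndpointR13SepCoPHV (stmt-QuantumFields-27366)`.
Filed `--kind proof --supports stmt-QuantumFields-27366 --as helper` — COUNT-NEUTRAL.  Theorems only; 0 `def`, 0 `sorry`.  Imports BY NAME FILE 150 `…CubeSmoothCutAdjointLetter` (through it FILE 148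
`projO_dressedV_comp_eq`, `hasMaj_neumannR_comp_loc₂`, FILE 43 `isUnit_neumannR`), FILE 152 `…SpeciesCommutatorAdjointSandwich` (`hasMaj_comp_commOp_dressedPert_of_sandwich`), dag-n15-w3 file 34
`…CubeSmoothCutDressed` (`hasMaj_smoothCutDressed_loc₂`, `hasMaj_smoothCut_flat`, `hasMaj_jet_smoothCut_flat`; file 31 `smoothCut_out`∕`smoothCut_in`; file 23 `hasMaj_dressedV_pair`), dag-n15-c g13 FILE 94
`…NeumannKnitRightCube` (`hasMaj_comp_commOp_lapOp_of_sandwich`), FILE 57 `hasMaj_comp_commOp_of_add`, dag-n15-w5 `commOp_sub_left`.  Nothing in the tree is modified; nothing restated.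

WHY.  FILE 147's adjoint gluing reads each cube through `hKc : G_□∘[Δ, M_{h_□}] ≤ 1_S1_S·θ₀e^{−δd}`.  For the live glued operator `Δ = Σ∇*∇ ⊗ 1 + W + N_L − 𝒱` (`𝒱 = (unstackM C A + N_V∘pr₀)∘jet`),
and the adjoint-side cube is the dressed smooth-cut cube `X° = pr₀∘bgPropV (stack (M_χ̃N) (jet∘M_χ̃N)) (unstackM C A + N_V∘pr₀)` with the UNCUT structural perturbation (dag-n15-w3 file 34's object).
dag-n15-w5's row for it displays the mixed sup rows `∇_jN∘∇^±_μ` (`hDQf∕hDQb`), not η-uniform (FILE 148's located obstruction).  The three halves of the commutator — flat `Σ∇*∇ + W` (FILE 49 ∕ g13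
FILE 94 `_of_sandwich`), nonlocal `N_L` (FILE 57), species `𝒱` (FILE 152 `_of_sandwich`) — only ever compose the cube's right entries with diagonal factors supported in the transition layers of
`h`, inside the cube where the interior cut `χ ≡ 1`; so the SANDWICHED right entries suffice, and FILES 148∕150 deliver them: `X°∘∇^±_μ∘M_χ = Ñ_𝒲∘(M_χ̃∘(N∘∇^±_μ∘M_χ)) = (Ñ_𝒲∘M_χ̃∘T^±_μ)∘M_χ` with
`N∘∇^±_μ∘M_χ = T^±_μ∘M_χ` (dag-n15-a N-IIn (a)±) and `𝒲`'s rows (FILE 150).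

WHAT.  §1 `comp_mulOp_of_sandwich` (`G∘Q∘M_χ = T∘M_χ`, `a = χa` ⟹ `(G∘Q)∘M_a = T∘M_a`), `smoothCutDressed_comp_grad_sandwich` (the identity above, both signs), ★ `hasMaj_adjRightEntry_loc₂`
(`Ñ_𝒲∘M_χ̃∘T ≤ 1_S1_S·(1 − θ_𝒲c_r)⁻¹β^Qc_r·e^{−(δ_W−2σ)d}`).  §2 ★★★ `hasMaj_smoothCutDressed_comp_commOp_cubeOp_out_of_sandwich`:
`X°∘[lapOp W + N_L − 𝒱, M_h] ≤ 1_S(y)·[(|J|(3β̄′c₂ + 2β^Xc₁) + θ_W + β̄′c_Nc_r) + (|J|·2r_A(c₁β̄′ + c₀β^X) + β̄′(ℓ(eε)⁻¹ + 2ω)R_Nc_r)]·e^{−ρ₃d}`, `β̄′ = β̄(1 − β̄Rc_r²)⁻¹`, `β̄ = β + (β₁ + c̃β)`,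
`β^X = (1 − θ_𝒲c_r)⁻¹β^Qc_r` — dag-n15-w5's constant with `β′₂ ↦ β^X`; hypotheses = file 34's (entry 0) + FILE 150's letter of `𝒲` (displayed as ONE row `θ_𝒲`) + the sandwiched `T^±` + the
transition layers inside `{χ = 1}` + w5's partition ∕ species ∕ nonlocal ∕ base letters.  NO mixed row.

HONEST FRAMING ∕ LIMITS.  Block-majorant bookkeeping over DISPLAYED letters; proves NO estimate of any concrete propagator; nothing of [B5]∕[B6]∕[B9] asserted ((1.120)–(1.128) pp.37–39,
(2.91)–(2.92) p.239, (2.133)–(2.134) p.247, (3.52) p.400, (3.62)–(3.65) pp.402–403, (3.76)–(3.77) pp.405–406 = SHAPES ∕ MECHANISM).  NE2⁺ NOT PRINTED, NOT proved; N15 NOT discharged; K3⁸ OPEN,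
skeleton v7 untouched (0∕2); counts of record UNMOVED by this seat (typed 28∕28 · discharged 7∕28 = 7∕27 excl. NODE O, №245); one finite 𝕋⁴ at fixed ε — NOT infinite volume, NOT OS on ℝ⁴, NOT a mass gap, NOT Clay; R4
closes the conditional finite-𝕋⁴ rung `BalabanLadder.UV` only.  Restate-immune (no Theses import).
-/

set_option autoImplicit false

noncomputable section
open scoped BigOperators
open Finset

namespace Summit.QuantumFields.YangMills.BalabanUVNodes.N15.Gluing

open Literature.MathematicalPhysics.QuantumFieldTheory.Balaban1983to89
open Literature.MathematicalPhysics.QuantumFieldTheory.Balaban1983to89.B11SectG (BlockNorm HasMaj RowSum)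
open Literature.MathematicalPhysics.QuantumFieldTheory.Balaban1983to89.B6RandomWalk (Triangle254)
open Literature.MathematicalPhysics.QuantumFieldTheory.Balaban1983to89.T4EtaRateCoeffDefect (diagK diagK_nonneg hasMaj_mulOp)
open Literature.MathematicalPhysics.QuantumFieldTheory.Balaban1983to89.B6Prop26Gluing (mulOp mulOp_apply ind ind_nonneg ind_le_one)
open Summit.QuantumFields.YangMills.BalabanUVNodes.N15.MatrixSpecies (mmulOp liftBlk liftEquiv liftEquiv_apply liftEquiv_symm_apply)
open Summit.QuantumFields.YangMills.BalabanUVNodes.N15.BackgroundLayer (fgrad bgrad fgradAdj fgrad_apply bgrad_apply stack projO projO_none_comp_stack unstackM bgPropV blkPair fgradMat)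
open Summit.QuantumFields.YangMills.BalabanUVNodes.N15.CurvedSpecies (hasMaj_smoothCutDressed_loc₂ hasMaj_smoothCut_flat hasMaj_jet_smoothCut_flat smoothCut_out smoothCut_in hasMaj_dressedV_pair
  hasMaj_smoothCut commOp_sub_left)

variable {X ι J : Type} [Fintype X] [DecidableEq X] [Fintype ι] [DecidableEq ι] [Fintype J] [DecidableEq J] {g : B6.Geometry} (blk : X → g.Site) (τ : J → X ≃ X) (n : ℝ)
  {σ cr : ℝ} {N : (X × ι → ℝ) →ₗ[ℝ] (X × ι → ℝ)} {χX χtX ψX ψ₂X : X → ℝ} {S : Set g.Site}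

/-! ## §1 The sandwiched right entries of the adjoint-side dressed cube -/

omit [Fintype X] [DecidableEq X] [Fintype ι] [DecidableEq ι] [Fintype J] [DecidableEq J] in
/-- THE SANDWICH PASSES TO A SCALAR FACTOR SUPPORTED INSIDE THE CUT: `G∘Q∘M_χ = T∘M_χ`, `χ = 1` on `supp a` ⟹ `G∘Q∘M_a = T∘M_a`. [cite: Balaban1984PropagatorsII, (2.133) p.247 (shape)] -/
theorem comp_mulOp_of_sandwich {G Q T : (X × ι → ℝ) →ₗ[ℝ] (X × ι → ℝ)} {a : X × ι → ℝ} (hs : G ∘ₗ Q ∘ₗ mulOp (fun p : X × ι => χX p.1) = T ∘ₗ mulOp (fun p : X × ι => χX p.1))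
    (ha : ∀ p, a p ≠ 0 → χX p.1 = 1) : G ∘ₗ Q ∘ₗ mulOp a = T ∘ₗ mulOp a := by
  have hcut : mulOp (fun p : X × ι => χX p.1) ∘ₗ mulOp a = mulOp a := by
    refine LinearMap.ext fun f => funext fun p => ?_
    simp only [LinearMap.comp_apply, mulOp_apply]
    by_cases h0 : a p = 0
    · simp [h0]
    · rw [ha p h0, one_mul]
  calc G ∘ₗ Q ∘ₗ mulOp a = G ∘ₗ Q ∘ₗ (mulOp (fun p : X × ι => χX p.1) ∘ₗ mulOp a) := by rw [hcut]
    _ = (G ∘ₗ Q ∘ₗ mulOp (fun p : X × ι => χX p.1)) ∘ₗ mulOp a := by simp only [LinearMap.comp_assoc]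
    _ = T ∘ₗ mulOp a := by rw [hs, LinearMap.comp_assoc, hcut]

/-- **THE SANDWICHED RIGHT ENTRY OF THE ADJOINT-SIDE DRESSED CUBE**: `X°∘Q∘M_χ = (Ñ_𝒲∘M_χ̃∘T)∘M_χ` from FILE 148 `projO_dressedV_comp_eq` and the flat cube's sandwich `N∘Q∘M_χ = T∘M_χ`.
[cite: Balaban1985BackgroundPropagators, (3.42) p.397 (entry 2: shape), (3.64)–(3.65) pp.402–403 (mechanism)] -/
theorem smoothCutDressed_comp_grad_sandwich {D : J ⊕ J → (X × ι → ℝ) →ₗ[ℝ] (X × ι → ℝ)} {V : ((X × ι) × Option (J ⊕ J) → ℝ) →ₗ[ℝ] (X × ι → ℝ)}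
    (hD : ∀ j, D j = (fun j => Sum.elim (fun μ => fgrad n (liftEquiv (τ μ) ι)) (fun μ => bgrad n (liftEquiv (τ μ) ι)) j) j ∘ₗ (mulOp (fun p : X × ι => χtX p.1) ∘ₗ N))
    (hunit : IsUnit (1 - LinearMap.toMatrix' (stack (mulOp (fun p : X × ι => χtX p.1) ∘ₗ N) D ∘ₗ V)))
    (hχ : mulOp (fun p : X × ι => χX p.1) ∘ₗ mulOp (fun p : X × ι => χtX p.1) = mulOp (fun p : X × ι => χtX p.1))
    (hunitW : IsUnit (1 - LinearMap.toMatrix' ((mulOp (fun p : X × ι => χtX p.1) ∘ₗ N) ∘ₗ V ∘ₗ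
      stack LinearMap.id (fun j => Sum.elim (fun μ => fgrad n (liftEquiv (τ μ) ι)) (fun μ => bgrad n (liftEquiv (τ μ) ι)) j) ∘ₗ mulOp (fun p : X × ι => χX p.1))))
    {Q T : (X × ι → ℝ) →ₗ[ℝ] (X × ι → ℝ)} (hT : N ∘ₗ Q ∘ₗ mulOp (fun p : X × ι => χX p.1) = T ∘ₗ mulOp (fun p : X × ι => χX p.1)) :
    (projO none ∘ₗ bgPropV (stack (mulOp (fun p : X × ι => χtX p.1) ∘ₗ N) D) V) ∘ₗ Q ∘ₗ mulOp (fun p : X × ι => χX p.1) =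
      (neumannR ((mulOp (fun p : X × ι => χtX p.1) ∘ₗ N) ∘ₗ V ∘ₗ
          stack LinearMap.id (fun j => Sum.elim (fun μ => fgrad n (liftEquiv (τ μ) ι)) (fun μ => bgrad n (liftEquiv (τ μ) ι)) j) ∘ₗ mulOp (fun p : X × ι => χX p.1)) ∘ₗ
        (mulOp (fun p : X × ι => χtX p.1) ∘ₗ T)) ∘ₗ mulOp (fun p : X × ι => χX p.1) := by
  have hGχ : mulOp (fun p : X × ι => χX p.1) ∘ₗ (mulOp (fun p : X × ι => χtX p.1) ∘ₗ N) = mulOp (fun p : X × ι => χtX p.1) ∘ₗ N := smoothCut_out hχ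
  have e := projO_dressedV_comp_eq hD hunit hGχ hunitW (Q ∘ₗ mulOp (fun p : X × ι => χX p.1))
  have hN : (mulOp (fun p : X × ι => χtX p.1) ∘ₗ N) ∘ₗ (Q ∘ₗ mulOp (fun p : X × ι => χX p.1)) = (mulOp (fun p : X × ι => χtX p.1) ∘ₗ T) ∘ₗ mulOp (fun p : X × ι => χX p.1) := by
    rw [LinearMap.comp_assoc, hT, ← LinearMap.comp_assoc]
  rw [e, hN, ← LinearMap.comp_assoc]

omit [Fintype J] [DecidableEq J] in
/-- ★ **THE SANDWICHED RIGHT ENTRY's ROWS, TWO-SIDED**: `𝒲 ≤ θ_𝒲e^{−δ_Wd}` (`θ_𝒲c_r < 1`), `T ≤ 1_S1_S·β^Qe^{−δ_Wd}` with `T∘M_{ψ₂} = T` (`supp ψ₂` over `S`), the cuts `M_χ𝒲 = 𝒲`, `M_χM_χ̃ = M_χ̃`, `|χ̃| ≤ 1`,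
`2σ ≤ δ_W` ⟹ `Ñ_𝒲∘M_χ̃∘T ≤ 1_S(y)1_S(y′)·(1 − θ_𝒲c_r)⁻¹β^Qc_r·e^{−(δ_W−2σ)d}` (FILE 148 `hasMaj_neumannR_comp_loc₂`). [cite: Balaban1984PropagatorsII, (2.133) p.247, (2.52)–(2.56) pp.232–233 (mechanism)] -/
theorem hasMaj_adjRightEntry_loc₂ (htri : Triangle254 g) (hd : ∀ a b : g.Site, 0 ≤ g.dist a b) (hd0 : ∀ y : g.Site, g.dist y y = 0) (hrow : RowSum g σ cr) (hσ : 0 ≤ σ) (hcr : 0 ≤ cr)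
    {W T : (X × ι → ℝ) →ₗ[ℝ] (X × ι → ℝ)} (hSχ : ∀ x, χX x ≠ 0 → blk x ∈ S) (hSψ₂ : ∀ x, ψ₂X x ≠ 0 → blk x ∈ S) (hχt : ∀ x, |χtX x| ≤ 1)
    (hWχ : mulOp (fun p : X × ι => χX p.1) ∘ₗ W = W) (hχ : mulOp (fun p : X × ι => χX p.1) ∘ₗ mulOp (fun p : X × ι => χtX p.1) = mulOp (fun p : X × ι => χtX p.1))
    (hTψ : T ∘ₗ mulOp (fun p : X × ι => ψ₂X p.1) = T) {βQ θW δW : ℝ} (hβQ : 0 ≤ βQ) (hθW : 0 ≤ θW) (hσδ : 2 * σ ≤ δW)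
    (hW : HasMaj (BlockNorm.ofBlocks g (liftBlk blk ι)) (BlockNorm.ofBlocks g (liftBlk blk ι)) W (fun y y' => θW * Real.exp (-(δW * g.dist y y'))))
    (hTr : HasMaj (BlockNorm.ofBlocks g (liftBlk blk ι)) (BlockNorm.ofBlocks g (liftBlk blk ι)) T (fun y y' => ind S y * ind S y' * (βQ * Real.exp (-(δW * g.dist y y'))))) (hq : θW * cr < 1) :
    HasMaj (BlockNorm.ofBlocks g (liftBlk blk ι)) (BlockNorm.ofBlocks g (liftBlk blk ι)) (neumannR W ∘ₗ (mulOp (fun p : X × ι => χtX p.1) ∘ₗ T))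
      (fun y y' => ind S y * ind S y' * ((1 - θW * cr)⁻¹ * βQ * cr * Real.exp (-((δW - 2 * σ) * g.dist y y')))) := by
  have hF : HasMaj (BlockNorm.ofBlocks g (liftBlk blk ι)) (BlockNorm.ofBlocks g (liftBlk blk ι)) (mulOp (fun p : X × ι => χtX p.1) ∘ₗ T) (fun y y' => βQ * Real.exp (-(δW * g.dist y y'))) :=
    (hasMaj_diag_comp (liftBlk blk ι) (fun _ => zero_le_one) (hasMaj_mulOp (g := g) (liftBlk blk ι) (m := fun _ => (1 : ℝ)) (fun _ => zero_le_one) (fun p : X × ι => hχt p.1))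
      (hTr.mono fun y y' => loc₂_le_plain hβQ y y')).mono fun y y' => le_of_eq (one_mul _)
  have hFχ : mulOp (fun p : X × ι => χX p.1) ∘ₗ (mulOp (fun p : X × ι => χtX p.1) ∘ₗ T) = mulOp (fun p : X × ι => χtX p.1) ∘ₗ T := by rw [← LinearMap.comp_assoc, hχ]
  have hFψ : (mulOp (fun p : X × ι => χtX p.1) ∘ₗ T) ∘ₗ mulOp (fun p : X × ι => ψ₂X p.1) = mulOp (fun p : X × ι => χtX p.1) ∘ₗ T := by rw [LinearMap.comp_assoc, hTψ]
  exact hasMaj_neumannR_comp_loc₂ blk htri hd hd0 hrow hσ hcr hSχ hSψ₂ hWχ hFχ hFψ hβQ hθW hσδ hW hF hq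

/-! ## §2 The adjoint remainder row of the adjoint-side dressed cube -/

/-- ★★★ **THE ADJOINT REMAINDER ROW OF THE ADJOINT-SIDE DRESSED SMOOTH-CUT CUBE, FROM SANDWICHED RIGHT ENTRIES** — FILE 147∕149's `hKc` for `X° = pr₀∘bgPropV (stack (M_χ̃N) (jet∘M_χ̃N)) (unstackM C A +
N_V∘pr₀)`.  Data: file 34's (the flat cube's cut rows `β, β₁` at rate `δ`, the bump `χ̃ ≺ χ` with its letters and insertions, the input cut `N = NM_ψ`, the perturbation's letter `R` at rate `δ_V`,
`β̄Rc_r² < 1`, `β̄ = β + (β₁ + c̃β)`, rates `ρ₁, ρ₂`); the adjoint letter `𝒲 ≤ θ_𝒲e^{−δ_Wd}` with `θ_𝒲c_r < 1` (FILE 150 supplies it), the flat cube's SANDWICHED right entries `N∘∇^±_μ∘M_χ = T^±_μ∘M_χ`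
with `T^±_μ ≤ 1_S1_S·β^Qe^{−δ_Wd}`, `T^±_μM_{ψ₂} = T^±_μ` (`supp ψ₂` over `S`), `ρ₂ + 2σ ≤ δ_W`; the partition `h = h_X∘pr₁` (letters `c₀, c₁, c₂`, within `ω` of an `ℓ`-block-Lipschitz block
constant) whose TRANSITION LAYERS lie where `χ = 1`; the species rows `r_A`; the adjoint `W`-row `θ_W`; the flat nonlocal summand's commutator letter `c_N` (rate `ρ_N`); the base part `R_N` (rate
`δ_N`); `ε > 0`, rates `0 ≤ ρ₃ ≤ ρ_N`, `ρ₃ ≤ δ_N − ε`, `ρ₃ + σ ≤ ρ₂`.  Then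
`X°∘[lapOp W + N_L − (unstackM C A + N_V∘pr₀)∘jet, M_h] ≤ 1_S(y)·[(|J|(3β̄′c₂ + 2β^Xc₁) + θ_W + β̄′c_Nc_r) + (|J|·2r_A(c₁β̄′ + c₀β^X) + β̄′(ℓ(eε)⁻¹ + 2ω)R_Nc_r)]·e^{−ρ₃d}`,
`β̄′ = β̄(1 − β̄Rc_r²)⁻¹`, `β^X = (1 − θ_𝒲c_r)⁻¹β^Qc_r` — NO mixed row. [cite: Balaban1984PropagatorsI, (1.120)–(1.128) pp.37–38, p.39 (adjoint representation); Balaban1984PropagatorsII, (2.91)–(2.92) p.239, (2.133)–(2.134) p.247 (shapes + mechanism, transposed); Balaban1985BackgroundPropagators, (3.52) p.400, (3.62)–(3.65) pp.402–403, (3.76)–(3.77) pp.405–406] -/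
theorem hasMaj_smoothCutDressed_comp_commOp_cubeOp_out_of_sandwich (htri : Triangle254 g) (hd : ∀ a b : g.Site, 0 ≤ g.dist a b) (hsymm : ∀ y y', g.dist y y' = g.dist y' y)
    (hd0 : ∀ y : g.Site, g.dist y y = 0) (hrow : RowSum g σ cr) (hσ : 0 ≤ σ)
    {ρ₁ ρ₂ ρ₃ ρN δV δN δW ε R c₀ c₁ c₂ θW cN rA RN ℓ ω β β₁ ct δ βQ θA : ℝ} {C : X → Matrix ι ι ℝ} {A : J ⊕ J → X → Matrix ι ι ℝ} {W NL NV : (X × ι → ℝ) →ₗ[ℝ] (X × ι → ℝ)}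
    {hX : X → ℝ} {hb : g.Site → ℝ} {Tf Tb : J → (X × ι → ℝ) →ₗ[ℝ] (X × ι → ℝ)}
    (hβ : 0 ≤ β) (hβ₁ : 0 ≤ β₁) (hβQ : 0 ≤ βQ) (hct : 0 ≤ ct) (hR : 0 ≤ R) (hcr : 0 ≤ cr) (hc₀ : 0 ≤ c₀) (hc₁ : 0 ≤ c₁) (hc₂ : 0 ≤ c₂) (hθW : 0 ≤ θW) (hcN : 0 ≤ cN) (hrA : 0 ≤ rA)
    (hRN : 0 ≤ RN) (hℓ : 0 ≤ ℓ) (hω : 0 ≤ ω) (hθA : 0 ≤ θA) (hε : 0 < ε)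
    (hσρ : σ ≤ ρ₁) (hρ₁V : ρ₁ ≤ δV) (hρ₁G : ρ₁ + σ ≤ δ) (hρ₂ : 0 ≤ ρ₂) (hρ₂₁ : ρ₂ + σ ≤ ρ₁) (hρ₃ : 0 ≤ ρ₃) (hρ₃N : ρ₃ ≤ ρN) (hρ₃V : ρ₃ ≤ δN - ε) (hρ₃₂ : ρ₃ + σ ≤ ρ₂)
    (hρ₂W : ρ₂ + 2 * σ ≤ δW)
    -- cuts
    (hSχ : ∀ x, χX x ≠ 0 → blk x ∈ S) (hSψ : ∀ x, ψX x ≠ 0 → blk x ∈ S) (hSψ₂ : ∀ x, ψ₂X x ≠ 0 → blk x ∈ S) (hχt : ∀ x, |χtX x| ≤ 1)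
    (hdχt : ∀ μ p, |fgrad n (liftEquiv (τ μ) ι) (fun p : X × ι => χtX p.1) p| ≤ ct) (hdχtb : ∀ μ p, |bgrad n (liftEquiv (τ μ) ι) (fun p : X × ι => χtX p.1) p| ≤ ct)
    (hsub : mulOp (fun p : X × ι => χtX p.1) ∘ₗ mulOp (fun p : X × ι => χX p.1) = mulOp (fun p : X × ι => χtX p.1))
    (hχ : mulOp (fun p : X × ι => χX p.1) ∘ₗ mulOp (fun p : X × ι => χtX p.1) = mulOp (fun p : X × ι => χtX p.1))
    (hs : ∀ μ, mulOp ((fun p : X × ι => χtX p.1) ∘ (liftEquiv (τ μ) ι)) ∘ₗ mulOp (fun p : X × ι => χX p.1) = mulOp ((fun p : X × ι => χtX p.1) ∘ (liftEquiv (τ μ) ι)))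
    (hsb : ∀ μ, mulOp ((fun p : X × ι => χtX p.1) ∘ (liftEquiv (τ μ) ι).symm) ∘ₗ mulOp (fun p : X × ι => χX p.1) = mulOp ((fun p : X × ι => χtX p.1) ∘ (liftEquiv (τ μ) ι).symm))
    (hdd : ∀ μ, mulOp (fgrad n (liftEquiv (τ μ) ι) (fun p : X × ι => χtX p.1)) ∘ₗ mulOp (fun p : X × ι => χX p.1) = mulOp (fgrad n (liftEquiv (τ μ) ι) (fun p : X × ι => χtX p.1)))
    (hddb : ∀ μ, mulOp (bgrad n (liftEquiv (τ μ) ι) (fun p : X × ι => χtX p.1)) ∘ₗ mulOp (fun p : X × ι => χX p.1) = mulOp (bgrad n (liftEquiv (τ μ) ι) (fun p : X × ι => χtX p.1)))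
    (hNψ : N ∘ₗ mulOp (fun p : X × ι => ψX p.1) = N)
    -- the flat cube: left cut rows, SANDWICHED right entries
    (hcut : HasMaj (BlockNorm.ofBlocks g (liftBlk blk ι)) (BlockNorm.ofBlocks g (liftBlk blk ι)) (mulOp (fun p : X × ι => χX p.1) ∘ₗ N) (fun y y' => ind S y * ind S y' * (β * Real.exp (-(δ * g.dist y y')))))
    (hcutF : ∀ μ, HasMaj (BlockNorm.ofBlocks g (liftBlk blk ι)) (BlockNorm.ofBlocks g (liftBlk blk ι)) (mulOp (fun p : X × ι => χX p.1) ∘ₗ (fgrad n (liftEquiv (τ μ) ι) ∘ₗ N))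
      (fun y y' => ind S y * ind S y' * (β₁ * Real.exp (-(δ * g.dist y y')))))
    (hcutB : ∀ μ, HasMaj (BlockNorm.ofBlocks g (liftBlk blk ι)) (BlockNorm.ofBlocks g (liftBlk blk ι)) (mulOp (fun p : X × ι => χX p.1) ∘ₗ (bgrad n (liftEquiv (τ μ) ι) ∘ₗ N))
      (fun y y' => ind S y * ind S y' * (β₁ * Real.exp (-(δ * g.dist y y')))))
    (hTf : ∀ μ, N ∘ₗ fgrad n (liftEquiv (τ μ) ι) ∘ₗ mulOp (fun p : X × ι => χX p.1) = Tf μ ∘ₗ mulOp (fun p : X × ι => χX p.1))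
    (hTb : ∀ μ, N ∘ₗ bgrad n (liftEquiv (τ μ) ι) ∘ₗ mulOp (fun p : X × ι => χX p.1) = Tb μ ∘ₗ mulOp (fun p : X × ι => χX p.1))
    (hTfr : ∀ μ, HasMaj (BlockNorm.ofBlocks g (liftBlk blk ι)) (BlockNorm.ofBlocks g (liftBlk blk ι)) (Tf μ) (fun y y' => ind S y * ind S y' * (βQ * Real.exp (-(δW * g.dist y y')))))
    (hTbr : ∀ μ, HasMaj (BlockNorm.ofBlocks g (liftBlk blk ι)) (BlockNorm.ofBlocks g (liftBlk blk ι)) (Tb μ) (fun y y' => ind S y * ind S y' * (βQ * Real.exp (-(δW * g.dist y y')))))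
    (hTfψ : ∀ μ, Tf μ ∘ₗ mulOp (fun p : X × ι => ψ₂X p.1) = Tf μ) (hTbψ : ∀ μ, Tb μ ∘ₗ mulOp (fun p : X × ι => ψ₂X p.1) = Tb μ)
    -- the perturbation's letter and smallness, the adjoint letter of `𝒲`
    (hV : HasMaj (BlockNorm.ofBlocks g (blkPair (liftBlk blk ι))) (BlockNorm.ofBlocks g (liftBlk blk ι)) (unstackM C A + NV ∘ₗ projO (none : Option (J ⊕ J))) (fun y y' => R * Real.exp (-(δV * g.dist y y'))))
    (hq : (β + (β₁ + ct * β)) * (R * cr) * cr < 1)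
    (hW𝒲 : HasMaj (BlockNorm.ofBlocks g (liftBlk blk ι)) (BlockNorm.ofBlocks g (liftBlk blk ι))
      ((mulOp (fun p : X × ι => χtX p.1) ∘ₗ N) ∘ₗ (unstackM C A + NV ∘ₗ projO (none : Option (J ⊕ J))) ∘ₗ
        stack LinearMap.id (fun j => Sum.elim (fun μ => fgrad n (liftEquiv (τ μ) ι)) (fun μ => bgrad n (liftEquiv (τ μ) ι)) j) ∘ₗ mulOp (fun p : X × ι => χX p.1))
      (fun y y' => θA * Real.exp (-(δW * g.dist y y')))) (hqA : θA * cr < 1)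
    -- the partition and its transition layers inside the cut
    (hh1 : ∀ μ x, |fgrad n (τ μ) hX x| ≤ c₁) (hh1b : ∀ μ x, |bgrad n (τ μ) hX x| ≤ c₁) (hh0 : ∀ μ x, |hX (τ μ x) - hX x| ≤ c₀)
    (hLip : ∀ y y', |hb y - hb y'| ≤ ℓ * g.dist y y') (hrh : ∀ x, |hX x - hb (blk x)| ≤ ω)
    (hh2 : ∀ μ p, |fgradAdj n (liftEquiv (τ μ) ι) (fgrad n (liftEquiv (τ μ) ι) (fun p : X × ι => hX p.1)) p| ≤ c₂)
    (hh2f : ∀ μ p, |fgrad n (liftEquiv (τ μ) ι) (fgrad n (liftEquiv (τ μ) ι) (fun p : X × ι => hX p.1)) p| ≤ c₂)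
    (hh2b : ∀ μ p, |bgrad n (liftEquiv (τ μ) ι) (bgrad n (liftEquiv (τ μ) ι) (fun p : X × ι => hX p.1) ∘ ⇑(liftEquiv (τ μ) ι)) p| ≤ c₂)
    (hlayf : ∀ μ x, hX x ≠ hX ((τ μ).symm x) → χX x = 1) (hlayb : ∀ μ x, hX (τ μ x) ≠ hX x → χX x = 1)
    -- species rows, adjoint `W`-row, nonlocal commutator letter, base part
    (hA : ∀ j x i, ∑ k, |A j x i k| ≤ rA)
    (hWrow : HasMaj (BlockNorm.ofBlocks g (liftBlk blk ι)) (BlockNorm.ofBlocks g (liftBlk blk ι))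
      ((projO none ∘ₗ bgPropV (stack (mulOp (fun p : X × ι => χtX p.1) ∘ₗ N)
        (fun j => Sum.elim (fun μ => fgrad n (liftEquiv (τ μ) ι)) (fun μ => bgrad n (liftEquiv (τ μ) ι)) j ∘ₗ (mulOp (fun p : X × ι => χtX p.1) ∘ₗ N))) (unstackM C A + NV ∘ₗ projO (none : Option (J ⊕ J)))) ∘ₗ
        commOp W (fun p : X × ι => hX p.1))
      (fun y y' => ind S y * ind S y' * (θW * Real.exp (-(ρ₂ * g.dist y y')))))
    (hKN : HasMaj (BlockNorm.ofBlocks g (liftBlk blk ι)) (BlockNorm.ofBlocks g (liftBlk blk ι)) (commOp NL (fun p : X × ι => hX p.1)) (fun y y' => cN * Real.exp (-(ρN * g.dist y y'))))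
    (hNV : HasMaj (BlockNorm.ofBlocks g (liftBlk blk ι)) (BlockNorm.ofBlocks g (liftBlk blk ι)) NV (fun y y' => RN * Real.exp (-(δN * g.dist y y')))) :
    HasMaj (BlockNorm.ofBlocks g (liftBlk blk ι)) (BlockNorm.ofBlocks g (liftBlk blk ι))
      ((projO none ∘ₗ bgPropV (stack (mulOp (fun p : X × ι => χtX p.1) ∘ₗ N)
        (fun j => Sum.elim (fun μ => fgrad n (liftEquiv (τ μ) ι)) (fun μ => bgrad n (liftEquiv (τ μ) ι)) j ∘ₗ (mulOp (fun p : X × ι => χtX p.1) ∘ₗ N))) (unstackM C A + NV ∘ₗ projO (none : Option (J ⊕ J)))) ∘ₗ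
        commOp (lapOp n (fun μ => liftEquiv (τ μ) ι) W + NL - (unstackM C A + NV ∘ₗ projO (none : Option (J ⊕ J))) ∘ₗ
          stack LinearMap.id (fun j => Sum.elim (fun μ => fgrad n (liftEquiv (τ μ) ι)) (fun μ => bgrad n (liftEquiv (τ μ) ι)) j)) (fun p : X × ι => hX p.1))
      (fun y y' => ind S y * (((((Fintype.card J : ℝ) * (3 * ((β + (β₁ + ct * β)) * (1 - (β + (β₁ + ct * β)) * (R * cr) * cr)⁻¹ * c₂) + 2 * (((1 - θA * cr)⁻¹ * βQ * cr) * c₁)) + θW)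
          + (β + (β₁ + ct * β)) * (1 - (β + (β₁ + ct * β)) * (R * cr) * cr)⁻¹ * cN * cr)
        + (((Fintype.card J : ℝ) * (2 * rA * (c₁ * ((β + (β₁ + ct * β)) * (1 - (β + (β₁ + ct * β)) * (R * cr) * cr)⁻¹) + c₀ * ((1 - θA * cr)⁻¹ * βQ * cr))))
          + (β + (β₁ + ct * β)) * (1 - (β + (β₁ + ct * β)) * (R * cr) * cr)⁻¹ * ((ℓ * (Real.exp 1 * ε)⁻¹ + 2 * ω) * RN) * cr)) * Real.exp (-(ρ₃ * g.dist y y')))) := by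
  have hβb : 0 ≤ β + (β₁ + ct * β) := by positivity
  have hB : 0 ≤ (β + (β₁ + ct * β)) * (1 - (β + (β₁ + ct * β)) * (R * cr) * cr)⁻¹ := mul_nonneg hβb (inv_nonneg.2 (by linarith))
  have hBX : 0 ≤ (1 - θA * cr)⁻¹ * βQ * cr := mul_nonneg (mul_nonneg (inv_nonneg.2 (by linarith)) hβQ) hcr
  have h2σ : 2 * σ ≤ δW := by linarith
  -- entry 0 of the dressed smooth-cut cube, two-sided (file 34)
  have hG0 := hasMaj_smoothCutDressed_loc₂ blk τ n htri hd hrow hσ hβ hβ₁ hct hR hcr hσρ hρ₁V hρ₁G hρ₂ hρ₂₁ hSχ hSψ hχt hdχt hdχtb hsub hχ hs hsb hdd hddb hNψ hcut hcutF hcutB hV hq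
  -- the units
  have hGf := hasMaj_smoothCut_flat blk (S := S) hβ hβ₁ hct hχt hsub hcut
  have hDf := hasMaj_jet_smoothCut_flat blk τ n (S := S) hβ hβ₁ hct hχt hdχt hdχtb hs hsb hdd hddb hcut hcutF hcutB
  have hunit := (hasMaj_dressedV_pair blk htri hd hrow hσ hβb hR hcr hσρ hρ₁V hρ₁G hρ₂ hρ₂₁ hGf hDf hV hq).1
  have hunitW := isUnit_neumannR (liftBlk blk ι) hd hrow hθA (by linarith) hW𝒲 hqA
  -- the sandwiched right entries of the adjoint-side dressed cube and their rows
  have hDj : ∀ j, (fun j => Sum.elim (fun μ => fgrad n (liftEquiv (τ μ) ι)) (fun μ => bgrad n (liftEquiv (τ μ) ι)) j ∘ₗ (mulOp (fun p : X × ι => χtX p.1) ∘ₗ N)) j =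
      (fun j => Sum.elim (fun μ => fgrad n (liftEquiv (τ μ) ι)) (fun μ => bgrad n (liftEquiv (τ μ) ι)) j) j ∘ₗ (mulOp (fun p : X × ι => χtX p.1) ∘ₗ N) := fun _ => rfl
  have hsXf := fun μ => smoothCutDressed_comp_grad_sandwich τ n (V := unstackM C A + NV ∘ₗ projO (none : Option (J ⊕ J))) hDj hunit hχ hunitW (hTf μ)
  have hsXb := fun μ => smoothCutDressed_comp_grad_sandwich τ n (V := unstackM C A + NV ∘ₗ projO (none : Option (J ⊕ J))) hDj hunit hχ hunitW (hTb μ)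
  have hWχ : mulOp (fun p : X × ι => χX p.1) ∘ₗ ((mulOp (fun p : X × ι => χtX p.1) ∘ₗ N) ∘ₗ (unstackM C A + NV ∘ₗ projO (none : Option (J ⊕ J))) ∘ₗ
      stack LinearMap.id (fun j => Sum.elim (fun μ => fgrad n (liftEquiv (τ μ) ι)) (fun μ => bgrad n (liftEquiv (τ μ) ι)) j) ∘ₗ mulOp (fun p : X × ι => χX p.1)) =
      (mulOp (fun p : X × ι => χtX p.1) ∘ₗ N) ∘ₗ (unstackM C A + NV ∘ₗ projO (none : Option (J ⊕ J))) ∘ₗ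
        stack LinearMap.id (fun j => Sum.elim (fun μ => fgrad n (liftEquiv (τ μ) ι)) (fun μ => bgrad n (liftEquiv (τ μ) ι)) j) ∘ₗ mulOp (fun p : X × ι => χX p.1) := by
    simp only [← LinearMap.comp_assoc]
    rw [hχ]
  have rate : ∀ {c : ℝ} (_ : 0 ≤ c) (y y' : g.Site), ind S y * ind S y' * (c * Real.exp (-((δW - 2 * σ) * g.dist y y'))) ≤ ind S y * ind S y' * (c * Real.exp (-(ρ₂ * g.dist y y'))) :=
    fun hc y y' => mul_le_mul_of_nonneg_left (exp_rate_mono hd hc (by linarith) y y') (mul_nonneg (ind_nonneg _ _) (ind_nonneg _ _))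
  have hTXf := fun μ => (hasMaj_adjRightEntry_loc₂ blk htri hd hd0 hrow hσ hcr hSχ hSψ₂ hχt hWχ hχ (hTfψ μ) hβQ hθA h2σ hW𝒲 (hTfr μ) hqA).mono fun y y' => rate hBX y y'
  have hTXb := fun μ => (hasMaj_adjRightEntry_loc₂ blk htri hd hd0 hrow hσ hcr hSχ hSψ₂ hχt hWχ hχ (hTbψ μ) hβQ hθA h2σ hW𝒲 (hTbr μ) hqA).mono fun y y' => rate hBX y y'
  -- the sandwiches with the partition's coefficients (supported in the transition layers, inside the cut)
  have hsD : ∀ μ, (projO none ∘ₗ bgPropV (stack (mulOp (fun p : X × ι => χtX p.1) ∘ₗ N)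
        (fun j => Sum.elim (fun μ => fgrad n (liftEquiv (τ μ) ι)) (fun μ => bgrad n (liftEquiv (τ μ) ι)) j ∘ₗ (mulOp (fun p : X × ι => χtX p.1) ∘ₗ N))) (unstackM C A + NV ∘ₗ projO (none : Option (J ⊕ J)))) ∘ₗ
      fgrad n (liftEquiv (τ μ) ι) ∘ₗ mulOp (fgrad n (liftEquiv (τ μ) ι) (fun p : X × ι => hX p.1) ∘ ⇑(liftEquiv (τ μ) ι).symm) =
      (neumannR ((mulOp (fun p : X × ι => χtX p.1) ∘ₗ N) ∘ₗ (unstackM C A + NV ∘ₗ projO (none : Option (J ⊕ J))) ∘ₗ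
          stack LinearMap.id (fun j => Sum.elim (fun μ => fgrad n (liftEquiv (τ μ) ι)) (fun μ => bgrad n (liftEquiv (τ μ) ι)) j) ∘ₗ mulOp (fun p : X × ι => χX p.1)) ∘ₗ
        (mulOp (fun p : X × ι => χtX p.1) ∘ₗ Tf μ)) ∘ₗ mulOp (fgrad n (liftEquiv (τ μ) ι) (fun p : X × ι => hX p.1) ∘ ⇑(liftEquiv (τ μ) ι).symm) := fun μ =>
    comp_mulOp_of_sandwich (hsXf μ) fun p hp => hlayf μ p.1 (by
      simp only [Function.comp_apply, fgrad_apply, liftEquiv_apply, liftEquiv_symm_apply, Equiv.apply_symm_apply] at hp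
      exact sub_ne_zero.mp (right_ne_zero_of_mul hp))
  have hsB : ∀ μ, (projO none ∘ₗ bgPropV (stack (mulOp (fun p : X × ι => χtX p.1) ∘ₗ N)
        (fun j => Sum.elim (fun μ => fgrad n (liftEquiv (τ μ) ι)) (fun μ => bgrad n (liftEquiv (τ μ) ι)) j ∘ₗ (mulOp (fun p : X × ι => χtX p.1) ∘ₗ N))) (unstackM C A + NV ∘ₗ projO (none : Option (J ⊕ J)))) ∘ₗ
      bgrad n (liftEquiv (τ μ) ι) ∘ₗ mulOp (bgrad n (liftEquiv (τ μ) ι) (fun p : X × ι => hX p.1) ∘ ⇑(liftEquiv (τ μ) ι)) =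
      (neumannR ((mulOp (fun p : X × ι => χtX p.1) ∘ₗ N) ∘ₗ (unstackM C A + NV ∘ₗ projO (none : Option (J ⊕ J))) ∘ₗ
          stack LinearMap.id (fun j => Sum.elim (fun μ => fgrad n (liftEquiv (τ μ) ι)) (fun μ => bgrad n (liftEquiv (τ μ) ι)) j) ∘ₗ mulOp (fun p : X × ι => χX p.1)) ∘ₗ
        (mulOp (fun p : X × ι => χtX p.1) ∘ₗ Tb μ)) ∘ₗ mulOp (bgrad n (liftEquiv (τ μ) ι) (fun p : X × ι => hX p.1) ∘ ⇑(liftEquiv (τ μ) ι)) := fun μ =>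
    comp_mulOp_of_sandwich (hsXb μ) fun p hp => hlayb μ p.1 (by
      simp only [Function.comp_apply, bgrad_apply, liftEquiv_apply, liftEquiv_symm_apply, Equiv.symm_apply_apply] at hp
      exact sub_ne_zero.mp (right_ne_zero_of_mul hp))
  -- the partition's first differences on the vector carrier
  have hh1v : ∀ μ p, |fgrad n (liftEquiv (τ μ) ι) (fun p : X × ι => hX p.1) p| ≤ c₁ := fun μ p => by simpa only [fgrad_apply, liftEquiv_apply] using hh1 μ p.1
  have hh1bv : ∀ μ p, |bgrad n (liftEquiv (τ μ) ι) (fun p : X × ι => hX p.1) p| ≤ c₁ := fun μ p => by simpa only [bgrad_apply, liftEquiv_symm_apply] using hh1b μ p.1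
  -- the flat half through the sandwiches (g13 FILE 94), plus the nonlocal summand (FILE 57)
  have hflat := hasMaj_comp_commOp_lapOp_of_sandwich (liftBlk blk ι) (e := fun μ => liftEquiv (τ μ) ι) hB hBX hc₁ hc₂ hh1v hh1bv hh2 hh2f hh2b hsD hsB hG0 hTXf hTXb hWrow
  have hθ : 0 ≤ Fintype.card J * (3 * ((β + (β₁ + ct * β)) * (1 - (β + (β₁ + ct * β)) * (R * cr) * cr)⁻¹ * c₂) + 2 * (((1 - θA * cr)⁻¹ * βQ * cr) * c₁)) + θW := by positivity
  have h1 := hasMaj_comp_commOp_of_add (liftBlk blk ι) htri hd hrow hσ hθ hcN hB hρ₃ hρ₃N hρ₃₂ hflat hKN hG0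
  -- the species + base half through the sandwiches (FILE 152)
  have hlayf' : ∀ μ x, hX x - hX ((τ μ).symm x) ≠ 0 → χX x = 1 := fun μ x h => hlayf μ x (sub_ne_zero.mp h)
  have hlayb' : ∀ μ x, hX (τ μ x) - hX x ≠ 0 → χX x = 1 := fun μ x h => hlayb μ x (sub_ne_zero.mp h)
  have h2 := hasMaj_comp_commOp_dressedPert_of_sandwich blk τ n C A hX _ htri hd hsymm hrow hσ hB hBX hc₁ hc₀ hrA hRN hℓ hω hε hρ₃ hρ₃V hρ₃₂ hh1 hh1b hh0 hLip hrh hA hlayf' hlayb'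
    hsXf hsXb hG0 hTXf hTXb hNV
  rw [commOp_sub_left, LinearMap.comp_sub]
  refine (h1.sub h2).mono fun y y' => le_of_eq ?_
  ring

end Summit.QuantumFields.YangMills.BalabanUVNodes.N15.Gluing

end
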